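import Summits.FinalStateConjecture.FinalStateConjecture.Theorems.ClusterCompletenessRecurrentlyFlatDispersesStubAnchorCone
import Summits.FinalStateConjecture.FinalStateConjecture.Theorems.ClusterCompletenessRecurrentlyFlatDispersesStubChartFuture
import Summits.FinalStateConjecture.FinalStateConjecture.Theorems.ClusterCompletenessRecurrentlyFlatDispersesFutureSetCone
import Literature.Geometry.Lorentzian.TimelikeRayCauchy

/-!
# Crux `RecurrentlyFlatDisperses` (stmt-FinalStateConjecture-14665), line `Sketch` — the anchored chart
# region has unbounded time separation to the future (no black hole of bounded interior lifetime)

Continuation lead c2, 2026-08-16. A consequence of the `C⁰` ANCHOR of the crux's flat late chart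
`Ψ₀ : U₀ → 𝒟`, `{x⁰ > τ₀} ⊆ U₀`, `‖Ψ₀^* g − η‖ ≤ 1/4` on every late slab, recorded for refuters and
auditors of this crux and of its siblings `RecurrentMultiKerrCapture` / `OmegaLimitMultiKerr`:
from every charted late point `Ψ₀ x`, `x⁰ > τ₀`, the Lorentzian distance (time separation) to
suitable charted late points is UNBOUNDED — the chart-vertical ray `s ↦ Ψ₀(x + δ(eˢ − 1)∂₀)`,
`δ = x⁰ − τ₀`, is a future causal curve (chart time runs to the future, landed `stub_chartFuture`)
of speed `≥ δ/2` (`g(dΨ₀ ∂₀, dΨ₀ ∂₀) ≤ −3/4`, landed `FutureSet.val_mfderiv_basisVector_zero_le`),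
so its length on `[0, S]` is `≥ δS/2`, and lengths bound the time separation from below
(`LorentzianMetric.arcLength_le_lorentzDist`). Since `I⁺` of the late image lies in the late image
(landed `stub_futureSet`), no point of the late image — nor of its chronological future — can lie in
a region all of whose points have bounded time separation to their future, such as a
Schwarzschild/Kerr black-hole interior; and no point of it lies in the chronological past of such a
region. In particular the anchored hypothesis of the crux is incompatible with a black hole of that
kind anywhere to the future of the chart, which is why the line commits to `N′ = 0`.

* `FutureDistance.exists_le_lorentzDist` — the geometric statement for any smooth chart map on an
  open set containing a late half-space whose vertical differential is uniformly timelike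
  (`g(dΨ₀ ∂₀, dΨ₀ ∂₀) ≤ −3/4`) and future-directed;
* `unbounded_lorentzDist` — the crux-vocabulary form (hypotheses = the crux's anchored conjuncts,
  verbatim), discharging the side conditions by the landed stubs.

Mathlib + the Statement cone + landed bricks only; no definitions, no named facts.
-/

noncomputable section

open scoped Manifold ContDiff Topology
open Bundle Filter Set Function TopologicalSpace Literature.Geometry.Lorentzian

namespace Summit.FinalStateConjecture.FinalStateConjecture.Theorems.RecurrentlyFlatDisperses

namespace FutureDistance

/-! ### The vertical exponential ray of the chart (as in the neighbours `stub_chartFuture`, `FutureSet`) -/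

/-- The chart-vertical curve `s ↦ x₀ + δ(eˢ - 1) ∂₀` of `E4` has derivative `δ eᵗ ∂₀` at `t`. -/
private theorem hasDerivAt_vert (x₀ : E4) (δ t : ℝ) :
    HasDerivAt (fun s : ℝ ↦ x₀ + (δ * (Real.exp s - 1)) • (E4.basisVector 0 : E4))
      ((δ * Real.exp t) • (E4.basisVector 0 : E4)) t := by
  have h1 : HasDerivAt (fun s : ℝ ↦ δ * (Real.exp s - 1)) (δ * Real.exp t) t := by
    simpa using ((Real.hasDerivAt_exp t).sub_const 1).const_mul δ
  simpa using (h1.smul_const (E4.basisVector 0 : E4)).const_add x₀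

/-- The time coordinate along the chart-vertical curve is `x₀⁰ + δ(eˢ - 1)`. -/
private theorem vert_apply_zero (x₀ : E4) (δ s : ℝ) :
    (x₀ + (δ * (Real.exp s - 1)) • (E4.basisVector 0 : E4)) 0 = x₀ 0 + δ * (Real.exp s - 1) := by
  simp [E4.basisVector]

/-- The chart-vertical curve is smooth (as a map `ℝ → E4`). -/
private theorem contDiff_vert (x₀ : E4) (δ : ℝ) :
    ContDiff ℝ ∞ (fun s : ℝ ↦ x₀ + (δ * (Real.exp s - 1)) • (E4.basisVector 0 : E4)) :=
  contDiff_const.add ((contDiff_const.mul (Real.contDiff_exp.sub contDiff_const)).smul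
    contDiff_const)

/-- The velocity of the chart-vertical curve (as a curve in the manifold `E4`) is `δ eᵗ ∂₀`. -/
private theorem velocity_vert (x₀ : E4) (δ t : ℝ) :
    velocity 𝓘(ℝ, E4) (fun s : ℝ ↦ x₀ + (δ * (Real.exp s - 1)) • (E4.basisVector 0 : E4)) t =
      (δ * Real.exp t) • (E4.basisVector 0 : E4) := by
  simp only [velocity]
  rw [mfderiv_eq_fderiv, ← toSpanSingleton_deriv, (hasDerivAt_vert x₀ δ t).deriv]
  exact one_smul ℝ _

/-- `B(a • w, a • w) = a² B(w, w)` for the metric at a point. -/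
private theorem val_smul_smul {E : Type*} [NormedAddCommGroup E] [NormedSpace ℝ E] {H : Type*}
    [TopologicalSpace H] {I : ModelWithCorners ℝ E H} {n : ℕ∞ω} {M : Type*} [TopologicalSpace M]
    [ChartedSpace H M] [IsManifold I ∞ M] (g : LorentzianMetric I n M) (x : M) (a : ℝ)
    (w : TangentSpace I x) : g.val x (a • w) (a • w) = a * a * g.val x w w := by
  rw [map_smul, map_smul, smul_apply, smul_eq_mul, smul_eq_mul, mul_assoc]

/-- Chain rule for velocities: `(f ∘ γ)'(t) = df_{γ t}(γ' t)`. -/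
private theorem velocity_comp' {E' : Type*} [NormedAddCommGroup E'] [NormedSpace ℝ E']
    {H' : Type*} [TopologicalSpace H'] {I' : ModelWithCorners ℝ E' H'} {N : Type*}
    [TopologicalSpace N] [ChartedSpace H' N]
    {E : Type*} [NormedAddCommGroup E] [NormedSpace ℝ E] {H : Type*} [TopologicalSpace H]
    {I : ModelWithCorners ℝ E H} {M : Type*} [TopologicalSpace M] [ChartedSpace H M]
    {f : N → M} {γ : ℝ → N} {t : ℝ} (hf : MDifferentiableAt I' I f (γ t))
    (hγ : MDifferentiableAt 𝓘(ℝ, ℝ) I' γ t) :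
    velocity I (f ∘ γ) t = mfderiv I' I f (γ t) (velocity I' γ t) := by
  simp only [velocity]
  rw [mfderiv_comp t hf hγ]
  rfl

/-- **The lifted vertical ray and its velocity.** For a smooth chart map `Ψ : U₀ → 𝓢` and a curve
`c : ℝ → U₀` whose underlying `E4`-curve is the chart-vertical curve `s ↦ x₀ + δ(eˢ - 1) ∂₀`, the
lift `Ψ ∘ c` is smooth and its velocity at `t` is `δ eᵗ · dΨ_{c t}(∂₀)` (chain rule; the inclusion
`U₀ ↪ E4` has identity differential, `mfderiv_subtypeVal`). -/
private theorem vertical_lift {𝓢 : Spacetime 4} {U₀ : Opens E4} {Ψ : U₀ → 𝓢.carrier}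
    (hΨ : ContMDiff 𝓘(ℝ, E4) (𝓡 4) ∞ Ψ) (x₀ : E4) (δ : ℝ) {c : ℝ → U₀}
    (hc : ∀ s : ℝ, (c s : E4) = x₀ + (δ * (Real.exp s - 1)) • (E4.basisVector 0 : E4)) :
    ContMDiff 𝓘(ℝ, ℝ) (𝓡 4) ∞ (Ψ ∘ c) ∧ ∀ t : ℝ, MDifferentiableAt 𝓘(ℝ, ℝ) (𝓡 4) (Ψ ∘ c) t ∧
      velocity (𝓡 4) (Ψ ∘ c) t =
        (δ * Real.exp t) • mfderiv 𝓘(ℝ, E4) (𝓡 4) Ψ (c t) (E4.basisVector 0) := by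
  have hcv :
      Subtype.val ∘ c = (fun s : ℝ ↦ x₀ + (δ * (Real.exp s - 1)) • (E4.basisVector 0 : E4)) :=
    funext hc
  have hp_smooth : ContMDiff 𝓘(ℝ, ℝ) 𝓘(ℝ, E4) ∞
      (fun s : ℝ ↦ x₀ + (δ * (Real.exp s - 1)) • (E4.basisVector 0 : E4)) :=
    contMDiff_iff_contDiff.mpr (contDiff_vert x₀ δ)
  have hc_smooth : ContMDiff 𝓘(ℝ, ℝ) 𝓘(ℝ, E4) ∞ c :=
    (ContMDiff.subtypeVal_comp_iff U₀ c).mp (hcv ▸ hp_smooth)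
  have hγ : ContMDiff 𝓘(ℝ, ℝ) (𝓡 4) ∞ (Ψ ∘ c) := hΨ.comp hc_smooth
  refine ⟨hγ, fun t ↦ ⟨hγ.mdifferentiableAt (by simp), ?_⟩⟩
  have hct : MDifferentiableAt 𝓘(ℝ, ℝ) 𝓘(ℝ, E4) c t := hc_smooth.mdifferentiableAt (by simp)
  have hΨt : MDifferentiableAt 𝓘(ℝ, E4) (𝓡 4) Ψ (c t) := hΨ.mdifferentiableAt (by simp)
  have hvc : velocity 𝓘(ℝ, E4) c t = (δ * Real.exp t) • (E4.basisVector 0 : E4) := by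
    have h1 : velocity 𝓘(ℝ, E4) (Subtype.val ∘ c) t =
        mfderiv 𝓘(ℝ, E4) 𝓘(ℝ, E4) (Subtype.val : U₀ → E4) (c t) (velocity 𝓘(ℝ, E4) c t) :=
      velocity_comp' (hasMFDerivAt_subtypeVal (c t)).mdifferentiableAt hct
    rw [mfderiv_subtypeVal, hcv, velocity_vert] at h1
    exact h1.symm
  rw [velocity_comp' hΨt hct, hvc]
  exact (mfderiv 𝓘(ℝ, E4) (𝓡 4) Ψ (c t)).map_smul (δ * Real.exp t) (E4.basisVector 0)

/-! ### Unbounded time separation along the vertical ray -/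

/-- **Unbounded time separation to the future inside an anchored chart.** Let `Ψ₀ : U₀ → 𝓢` be a
smooth chart map on an open `U₀ ⊇ {x⁰ > τ₀}` of `E4` whose vertical differential `dΨ₀(∂₀)` is
uniformly timelike, `g(dΨ₀ ∂₀, dΨ₀ ∂₀) ≤ -3/4`, and future-directed at every late point. Then for
every late point `x` (`x⁰ > τ₀`) and every `L` there is a late point `y` of `U₀` (on the vertical
ray above `x`) with time separation `d(Ψ₀ x, Ψ₀ y) ≥ L`: the ray `s ↦ Ψ₀(x + δ(eˢ − 1)∂₀)`,
`δ = x⁰ − τ₀`, is a future causal curve of speed `≥ δ/2` on `[0, S]`, hence of length `≥ δS/2`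
(`PseudoRiemannianMetric.ofReal_mul_le_arcLength`), and `L(γ) ≤ d(γ 0, γ S)`
(`LorentzianMetric.arcLength_le_lorentzDist`, O'Neill 1983, Ch. 14, Def. 14.15). -/
theorem exists_le_lorentzDist {𝓢 : Spacetime 4} {U₀ : Opens E4} {Ψ₀ : U₀ → 𝓢.carrier} {τ₀ : ℝ}
    (hΨs : ContMDiff 𝓘(ℝ, E4) (𝓡 4) ∞ Ψ₀) (hU : {x : E4 | τ₀ < x 0} ⊆ (U₀ : Set E4))
    (hvert : ∀ y : U₀, τ₀ < y.1 0 →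
      𝓢.metric.val (Ψ₀ y) (mfderiv 𝓘(ℝ, E4) (𝓡 4) Ψ₀ y (E4.basisVector 0))
          (mfderiv 𝓘(ℝ, E4) (𝓡 4) Ψ₀ y (E4.basisVector 0)) ≤ -(3 / 4) ∧
        𝓢.timeOrientation.IsFutureDirected (mfderiv 𝓘(ℝ, E4) (𝓡 4) Ψ₀ y (E4.basisVector 0)))
    (x : U₀) (hx : τ₀ < x.1 0) (L : ℝ) :
    ∃ y : U₀, τ₀ < y.1 0 ∧
      ENNReal.ofReal L ≤ 𝓢.metric.lorentzDist 𝓢.timeOrientation (Ψ₀ x) (Ψ₀ y) := by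
  set g := 𝓢.metric with hg
  set τ := 𝓢.timeOrientation with hτ
  -- the vertical ray through `x`
  set δ : ℝ := x.1 0 - τ₀ with hδ
  have hδpos : 0 < δ := sub_pos.mpr hx
  have hpt : ∀ s : ℝ, τ₀ < (x.1 + (δ * (Real.exp s - 1)) • (E4.basisVector 0 : E4)) 0 := by
    intro s
    rw [vert_apply_zero]
    have : 0 < δ * Real.exp s := mul_pos hδpos (Real.exp_pos s)
    linarith
  set c : ℝ → U₀ := fun s ↦ ⟨x.1 + (δ * (Real.exp s - 1)) • (E4.basisVector 0 : E4), hU (hpt s)⟩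
    with hc
  have hcval : ∀ s : ℝ, (c s : E4) = x.1 + (δ * (Real.exp s - 1)) • (E4.basisVector 0 : E4) :=
    fun s ↦ rfl
  have hc0 : c 0 = x := Subtype.ext (by simp [hc])
  have hclate : ∀ s : ℝ, τ₀ < (c s).1 0 := hpt
  obtain ⟨-, hvel⟩ := vertical_lift (𝓢 := 𝓢) hΨs x.1 δ (c := c) hcval
  set γ : ℝ → 𝓢.carrier := Ψ₀ ∘ c with hγdef
  have hγ0 : γ 0 = Ψ₀ x := by
    show Ψ₀ (c 0) = Ψ₀ x
    rw [hc0]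
  -- speed: `g(γ', γ') = (δ eˢ)² g(dΨ₀ ∂₀, dΨ₀ ∂₀) ≤ -(3/4) δ²` for `s ≥ 0`
  have hval : ∀ s : ℝ, 0 ≤ s →
      g.val (γ s) (velocity (𝓡 4) γ s) (velocity (𝓡 4) γ s) ≤ -(3 / 4 * δ ^ 2) := by
    intro s hs
    have e : g.val (γ s) (velocity (𝓡 4) γ s) (velocity (𝓡 4) γ s) =
        δ * Real.exp s * (δ * Real.exp s) *
          g.val (Ψ₀ (c s)) (mfderiv 𝓘(ℝ, E4) (𝓡 4) Ψ₀ (c s) (E4.basisVector 0))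
            (mfderiv 𝓘(ℝ, E4) (𝓡 4) Ψ₀ (c s) (E4.basisVector 0)) := by
      rw [(hvel s).2]
      exact val_smul_smul g (γ s) (δ * Real.exp s) _
    rw [e]
    have h1 := (hvert (c s) (hclate s)).1
    have h2 : δ ≤ δ * Real.exp s := le_mul_of_one_le_right hδpos.le (Real.one_le_exp hs)
    have h3 : 0 < δ * Real.exp s := mul_pos hδpos (Real.exp_pos s)
    have hAA : δ * δ ≤ δ * Real.exp s * (δ * Real.exp s) := mul_le_mul h2 h2 hδpos.le h3.le
    have hG : δ * Real.exp s * (δ * Real.exp s) *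
        g.val (Ψ₀ (c s)) (mfderiv 𝓘(ℝ, E4) (𝓡 4) Ψ₀ (c s) (E4.basisVector 0))
          (mfderiv 𝓘(ℝ, E4) (𝓡 4) Ψ₀ (c s) (E4.basisVector 0)) ≤
        δ * Real.exp s * (δ * Real.exp s) * (-(3 / 4)) :=
      mul_le_mul_of_nonneg_left h1 (mul_self_nonneg _)
    nlinarith [hAA, hG]
  have hfd : ∀ s : ℝ, τ.IsFutureDirected (velocity (𝓡 4) γ s) := by
    intro s
    rw [(hvel s).2]
    exact (hvert (c s) (hclate s)).2.smul (mul_pos hδpos (Real.exp_pos s))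
  -- the segment `[0, S]` with `δ S / 2 ≥ L`
  set S : ℝ := 2 * max L 0 / δ + 1 with hS
  have hS0 : 0 < S := by positivity
  have hcurve : g.IsFutureCausalCurveOn τ γ (Icc 0 S) := fun s _ ↦ ⟨(hvel s).1, hfd s⟩
  have hspeed : ∀ s ∈ Icc 0 S, δ / 2 ≤ g.speed γ s := by
    intro s hs
    have h1 := hval s hs.1
    have hδ2 : 0 < δ ^ 2 := by positivity
    rw [PseudoRiemannianMetric.speed_eq_sqrt_neg_of_nonpos (by nlinarith)]
    refine (Real.le_sqrt' (by positivity)).2 ?_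
    nlinarith
  have hlen : ENNReal.ofReal (δ / 2 * (S - 0)) ≤ g.arcLength γ 0 S :=
    PseudoRiemannianMetric.ofReal_mul_le_arcLength (by positivity) hspeed
  have hdist : g.arcLength γ 0 S ≤ g.lorentzDist τ (Ψ₀ x) (Ψ₀ (c S)) :=
    LorentzianMetric.arcLength_le_lorentzDist hS0 hcurve hγ0 rfl
  refine ⟨c S, hclate S, ?_⟩
  have hLS : L ≤ δ / 2 * (S - 0) := by
    have e : δ / 2 * (S - 0) = max L 0 + δ / 2 := by
      rw [hS]
      field_simp
      ring
    rw [e]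
    linarith [le_max_left L 0]
  exact (ENNReal.ofReal_le_ofReal hLS).trans (hlen.trans hdist)

end FutureDistance

/-- **The anchored chart region has unbounded time separation to the future** (crux
stmt-FinalStateConjecture-14665, line `Sketch`; hypotheses = the crux's anchored conjuncts verbatim):
for every charted late point `Ψ₀ x`, `x⁰ > τ₀`, and every `L : ℝ` there is a charted late point
`Ψ₀ y` with `d(Ψ₀ x, Ψ₀ y) ≥ L`. The pointwise anchor is the landed `stub_anchorCone`, the orientation
of chart time the landed `stub_chartFuture`, the cone bound `FutureSet.val_mfderiv_basisVector_zero_le`.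
Consequence (with the landed `stub_futureSet`, `I⁺(Ψ₀{x⁰ > τ₀}) ⊆ Ψ₀{x⁰ > τ₀}`): no point of the late
image or of its chronological future lies in, or in the chronological past of, a region whose points
have bounded time separation to their future (a Schwarzschild/Kerr black-hole interior): the
anchored hypothesis excludes such black holes to the future of the chart. -/
theorem unbounded_lorentzDist :
    ∀ (X : Type) [TopologicalSpace X] [ChartedSpace E3 X] [IsManifold (𝓡 3) ∞ X] [T2Space X]
      [SecondCountableTopology X] [ConnectedSpace X],
      ∀ D ∈ admissibleVacuumData X, ∀ 𝒟 : VacuumCauchyDevelopment D, 𝒟.IsMaximal →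
        ∀ (O : Set 𝒟.carrier) (τ₀ : ℝ) (U₀ : Opens E4) (Ψ₀ : U₀ → 𝒟.carrier),
          (𝒟.toSpacetime.IsLateChart (Minkowski.backgroundOn U₀) O τ₀ Ψ₀ ∧
            {x : E4 | τ₀ < x 0} ⊆ (U₀ : Set E4) ∧
            O = Summit.FinalStateConjecture.exteriorOf 𝒟.toCauchyDevelopment
              (Ψ₀ '' (Minkowski.backgroundOn U₀).lateRegion τ₀) ∧
            (∀ τ₁ : ℝ, τ₀ < τ₁ → O \ Ψ₀ '' (Minkowski.backgroundOn U₀).lateRegion τ₁ ⊆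
              𝒟.metric.causalPast 𝒟.timeOrientation
                (Ψ₀ '' (Minkowski.backgroundOn U₀).timeSlab τ₁)) ∧
            (∀ τ : ℝ, τ₀ < τ → 𝒟.toSpacetime.deviationCk (Minkowski.backgroundOn U₀) Ψ₀ 0 τ ≤
              ENNReal.ofReal (1 / 4))) →
          ∀ x : U₀, τ₀ < x.1 0 → ∀ L : ℝ, ∃ y : U₀, τ₀ < y.1 0 ∧
            ENNReal.ofReal L ≤ 𝒟.metric.lorentzDist 𝒟.timeOrientation (Ψ₀ x) (Ψ₀ y) := by
  intro X _ _ _ _ _ _ D hD 𝒟 hmax O τ₀ U₀ Ψ₀ hyp x hx L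
  -- the pointwise anchor and the orientation of chart time (landed neighbours)
  have hdev : ∀ y : U₀, τ₀ < y.1 0 →
      ‖𝒟.toSpacetime.deviation (Minkowski.backgroundOn U₀) Ψ₀ y‖ ≤ 1 / 4 :=
    stub_anchorCone X D hD 𝒟 hmax O τ₀ U₀ Ψ₀ hyp
  have hfut : ∀ y : U₀, τ₀ < y.1 0 →
      𝒟.timeOrientation.IsFutureDirected (mfderiv 𝓘(ℝ, E4) (𝓡 4) Ψ₀ y (E4.basisVector 0)) :=
    stub_chartFuture stub_anchorCone X D hD 𝒟 hmax O τ₀ U₀ Ψ₀ hyp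
  obtain ⟨hchart, hU, -, -, -⟩ := hyp
  exact FutureDistance.exists_le_lorentzDist (𝓢 := 𝒟.toSpacetime) hchart.contMDiff hU
    (fun y hy ↦ ⟨FutureSet.val_mfderiv_basisVector_zero_le Ψ₀ y (hdev y hy), hfut y hy⟩) x hx L

end Summit.FinalStateConjecture.FinalStateConjecture.Theorems.RecurrentlyFlatDisperses

end
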